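import Summits.HodgeConjecture.HodgeConjecture.Theorems.CyclicUnitaryPowersPLPackageOfMeridians
import Summits.HodgeConjecture.HodgeConjecture.Theorems.SignSymmetricPowersFibreCoreC
import Literature.AlgebraicGeometry.HodgeTheory.CyclicReflectionOfLocalisation
import HarnessLib

/-!
# K1-A: the monodromy of the cyclic family preserves the cup form `B`, and the cited meridian fact reduces to a
# LOCALISATION DATUM (route `CyclicUnitaryPowers`, item stmt-HodgeConjecture-19544)

Helper file (`--supports stmt-HodgeConjecture-19544`) of the prover seat `hodge-nonav-prover-Ax` (g8), cell `hodge-nonav`.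
Sorry-free; no definition, no named fact; nothing here says HC ∕ HC_AV is proved.

* §1 **`transportedTraceForm_of_mem_ratMonodromyGroup`** — every element of the rational monodromy group
  `Γ = ratMonodromyGroup (cyclicCoverFamily p) 2 _ [F]` is an isometry of the cup form `B = transportedTraceForm hX e 2`
  (fact-free: the hyperplane class of `𝒴 → 𝒴_U → ℙ³` restricts to a hard Lefschetz class on the fibre, so transports
  along loops preserve cup products landing in `H⁴` — `SignSymmetricPowersFibreCoreB.bettiCup_eq_of_isRatTransport` — and
  `e^*` is multiplicative, `BettiUniverse.pull_cup`).
* §2 **`meridian_clauses_of_localisation`** — consequently, for a rational transport `T` along any loop (e.g. a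
  meridian), ALL the conclusions of the cited facts `carlsonToledo1999_(nodal)MeridianMonodromy_isCyclicReflection`
  (`δ ≠ 0`, `Σ_{i<p} τ^i δ = 0`, `dim ℚ[τ]δ = p − 1`, `B|_{ℚ[τ]δ}` non-degenerate, `IsCyclicReflection B τ δ T`) follow
  from a LOCALISATION DATUM alone: a subspace `W ≠ 0` of `H²(𝒴_{[F]}; ℚ)` with `T x − x ∈ W`, `T = τ` on `W`,
  `Σ_{i<p} τ^i = 0` on `W` and `dim W ≤ p − 1` (`p` prime) — the formal assembly
  `exists_cyclicReflection_data_of_localisation` with `B` non-degenerate (`transportedTraceForm_nondegenerate`) and §1.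
  This is the exact remaining content of programme I2 (the local model — `μ = p − 1`, no invariants, `Σ τ^i = 0`,
  model monodromy = covering rotation — is PROVED in `Literature/Geometry/ComplexAnalytic/PhamBrieskorn*`).

## References

* [CarlsonToledo1999] J. A. Carlson, D. Toledo, Duke Math. J. 97 (1999), §6 Proposition.
* [VoisinHodgeII2003] C. Voisin, Hodge Theory and Complex Algebraic Geometry II, §3.1.2, §3.2.3.
-/

noncomputable section

set_option linter.dupNamespace false

open CategoryTheory AlgebraicGeometry
open Literature.AlgebraicTopology.SingularHomology
open Literature.AlgebraicGeometry.Motives Literature.AlgebraicGeometry.Motives.UniversalHypersurface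
open Literature.AlgebraicGeometry.HodgeTheory Literature.AlgebraicGeometry.HodgeTheory.UniversalHypersurface
open Summit.HodgeConjecture.HodgeConjecture.Theorems.SignSymmetricPowersFibreCoreB

namespace Summit.HodgeConjecture.HodgeConjecture.Theorems.CyclicUnitaryPowersMonodromyIsometry

variable {p : ℕ} [NeZero p] {f : MvPolynomial (Fin 3) ℂ}

/-! ### §1 The monodromy group preserves the cup form -/

/-- **The monodromy of the cyclic family preserves cup products landing in `H⁴`**: for `g ∈ Γ`,
`g x ∪ g y = x ∪ y` in `H⁴(𝒴_{[F]}(ℂ); ℚ)` (the hyperplane class of `𝒴 → ℙ³` restricts to a hard Lefschetz class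
of the fibre `𝒴_{[F]} ≅ X_F ⊂ ℙ³`). [cite: VoisinHodgeII2003, §3.1.2 and §3.2.3] -/
theorem cup_eq_of_mem_ratMonodromyGroup (hf : f.IsHomogeneous p)
    (hJ : SmoothHypersurface.IsNonsingularForm ℂ (cyclicCoverForm p f))
    {g : bettiCohomology (fiberOver (cyclicCoverFamily p) (cyclicCoverPoint p f)) 2 ≃ₗ[ℚ]
      bettiCohomology (fiberOver (cyclicCoverFamily p) (cyclicCoverPoint p f)) 2}
    (hg : g ∈ ratMonodromyGroup (cyclicCoverFamily p) 2 (cyclicCoverFamily_locallyTrivial p)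
      ⟨cyclicCoverPoint p f, Set.mem_univ _⟩)
    (x y : bettiCohomology (fiberOver (cyclicCoverFamily p) (cyclicCoverPoint p f)) 2) :
    BettiUniverse.cup _ 2 2 (g x) (g y) = BettiUniverse.cup _ 2 2 x y := by
  obtain ⟨γ, hγ⟩ := hg
  obtain ⟨a, ha, ha0⟩ := exists_isRationalClass_ne_zero_projectiveSpace_two (N := 3) (by omega)
  obtain ⟨e, he⟩ := CyclicUnitaryPowersPLPackageOfMeridians.exists_isCompatibleFibreIso p hf hJ
  have he' : fiberι (cyclicCoverFamily p) (cyclicCoverPoint p f) ≫ totalSpzToTotal ℂ 2 p (cyclicCoverSpz p) ≫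
      Literature.AlgebraicGeometry.HodgeTheory.UniversalHypersurface.toProjectiveSpace ℂ 2 p =
        e.hom ≫ SmoothHypersurface.hypersurfaceι (cyclicCoverForm p f) :=
    ((isCompatibleFibreIso_iff p e).1 he).symm
  have hXs : IsSmoothProjective 2 (fiberOver (cyclicCoverFamily p) (cyclicCoverPoint p f)) :=
    (isSmoothProjectiveFamily_cyclicCoverFamily p).isSmoothProjective _
  haveI : IsClosedImmersion (e.hom ≫ SmoothHypersurface.hypersurfaceι (cyclicCoverForm p f)).left := by
    rw [Over.comp_left]
    infer_instance
  -- the hyperplane class of the fibre `𝒴_{[F]} ≅ X_F ⊂ ℙ³` has hard Lefschetz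
  have hL := hasHardLefschetzProperty_map_of_isClosedImmersion (m := 1) hXs
    (e.hom ≫ SmoothHypersurface.hypersurfaceι (cyclicCoverForm p f)) ha ha0
  rw [← he'] at hL
  -- it is the restriction of the global hyperplane class of `𝒴 → 𝒴_U → ℙ³`
  have hK : complexBetti.map (fiberι (cyclicCoverFamily p) (cyclicCoverPoint p f)) 2
      (complexBetti.map (totalSpzToTotal ℂ 2 p (cyclicCoverSpz p) ≫
        Literature.AlgebraicGeometry.HodgeTheory.UniversalHypersurface.toProjectiveSpace ℂ 2 p) 2 a) =
      complexBetti.map (fiberι (cyclicCoverFamily p) (cyclicCoverPoint p f) ≫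
        totalSpzToTotal ℂ 2 p (cyclicCoverSpz p) ≫
          Literature.AlgebraicGeometry.HodgeTheory.UniversalHypersurface.toProjectiveSpace ℂ 2 p) 2 a := by
    rw [← CategoryTheory.comp_apply, ← complexBetti.map_comp]
  rw [← hK] at hL
  exact bettiCup_eq_of_isRatTransport (cyclicCoverFamily p) (cyclicCoverFamily_locallyTrivial p) _ (n := 2)
    (s := ⟨cyclicCoverPoint p f, Set.mem_univ _⟩) hXs hL γ (two_mul 2).symm rfl hγ hγ x y

/-- **The monodromy group is contained in the isometry group of the cup form `B = transportedTraceForm hX e 2`**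
(`B(x, y) = tr_{X_F}((e⁻¹)^* x ∪ (e⁻¹)^* y) = tr_{X_F}((e⁻¹)^*(x ∪ y))`, and `g x ∪ g y = x ∪ y`). Fact-free.
[cite: VoisinHodgeII2003, §3.2.3 (the monodromy preserves the intersection form)] -/
theorem transportedTraceForm_of_mem_ratMonodromyGroup (hf : f.IsHomogeneous p)
    (hX : IsSmoothProjective 2 (SmoothHypersurface.hypersurface (cyclicCoverForm p f)))
    (hJ : SmoothHypersurface.IsNonsingularForm ℂ (cyclicCoverForm p f))
    (e : fiberOver (cyclicCoverFamily p) (cyclicCoverPoint p f) ≅ SmoothHypersurface.hypersurface (cyclicCoverForm p f))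
    {g : bettiCohomology (fiberOver (cyclicCoverFamily p) (cyclicCoverPoint p f)) 2 ≃ₗ[ℚ]
      bettiCohomology (fiberOver (cyclicCoverFamily p) (cyclicCoverPoint p f)) 2}
    (hg : g ∈ ratMonodromyGroup (cyclicCoverFamily p) 2 (cyclicCoverFamily_locallyTrivial p)
      ⟨cyclicCoverPoint p f, Set.mem_univ _⟩)
    (x y : bettiCohomology (fiberOver (cyclicCoverFamily p) (cyclicCoverPoint p f)) 2) :
    transportedTraceForm hX e 2 (g x) (g y) = transportedTraceForm hX e 2 x y := by
  simp only [transportedTraceForm_apply, BettiUniverse.pullEquiv_apply, ← BettiUniverse.pull_cup,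
    cup_eq_of_mem_ratMonodromyGroup hf hJ hg x y]

/-! ### §2 The cited meridian clauses from a localisation datum -/

/-- **All conclusions of the cited meridian facts from a LOCALISATION DATUM** (formal, fact-free): let `T` be the
rational transport of the cyclic family along a loop `γ` at `[F]` (`p` prime, `f ≠ 0`), `τ` a linear automorphism of
`H²(𝒴_{[F]}; ℚ)` and `W ≠ 0` a subspace with `T x − x ∈ W`, `T = τ` on `W`, `Σ_{i<p} τ^i = 0` on `W`, `dim W ≤ p − 1`.
Then some `δ ≠ 0` has `Σ_{i<p} τ^i δ = 0`, `dim ℚ[τ]δ = p − 1`, `B|_{ℚ[τ]δ}` non-degenerate and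
`IsCyclicReflection B τ δ T` — the conjunction asserted by `carlsonToledo1999_nodalMeridianMonodromy_isCyclicReflection`.
[cite: CarlsonToledo1999, §6 Proposition (held text p0013–p0014)] -/
theorem meridian_clauses_of_localisation (hp : p.Prime) (hf : f.IsHomogeneous p)
    (hX : IsSmoothProjective 2 (SmoothHypersurface.hypersurface (cyclicCoverForm p f)))
    (hJ : SmoothHypersurface.IsNonsingularForm ℂ (cyclicCoverForm p f))
    (e : fiberOver (cyclicCoverFamily p) (cyclicCoverPoint p f) ≅ SmoothHypersurface.hypersurface (cyclicCoverForm p f))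
    (τ : bettiCohomology (fiberOver (cyclicCoverFamily p) (cyclicCoverPoint p f)) 2 ≃ₗ[ℚ]
      bettiCohomology (fiberOver (cyclicCoverFamily p) (cyclicCoverPoint p f)) 2)
    {γ : Path.Homotopic.Quotient
      (⟨cyclicCoverPoint p f, Set.mem_univ _⟩ : (Set.univ : Set (ComplexPoints (cyclicCoverBase p))))
      ⟨cyclicCoverPoint p f, Set.mem_univ _⟩}
    {T : bettiCohomology (fiberOver (cyclicCoverFamily p) (cyclicCoverPoint p f)) 2 ≃ₗ[ℚ]
      bettiCohomology (fiberOver (cyclicCoverFamily p) (cyclicCoverPoint p f)) 2}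
    (hT : IsRatTransport (cyclicCoverFamily p) 2 (cyclicCoverFamily_locallyTrivial p) γ T)
    (W : Submodule ℚ (bettiCohomology (fiberOver (cyclicCoverFamily p) (cyclicCoverPoint p f)) 2))
    (hrange : ∀ x, T x - x ∈ W) (hTτ : ∀ w ∈ W, T w = τ w)
    (hsum : ∀ w ∈ W, ∑ i ∈ Finset.range p, (τ ^ i) w = 0) (hdim : Module.finrank ℚ W ≤ p - 1) (hW0 : W ≠ ⊥) :
    ∃ δ : bettiCohomology (fiberOver (cyclicCoverFamily p) (cyclicCoverPoint p f)) 2,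
      δ ≠ 0 ∧ (∑ i ∈ Finset.range p, (τ ^ i) δ) = 0 ∧
      Module.finrank ℚ (cyclicSpan τ δ) = p - 1 ∧
      (∀ x ∈ cyclicSpan τ δ, (∀ y ∈ cyclicSpan τ δ, transportedTraceForm hX e 2 x y = 0) → x = 0) ∧
      IsCyclicReflection (transportedTraceForm hX e 2) τ δ T := by
  haveI : Module.Finite ℚ (bettiCohomology (fiberOver (cyclicCoverFamily p) (cyclicCoverPoint p f)) 2) :=
    BettiUniverse.finite ((isSmoothProjectiveFamily_cyclicCoverFamily p).isSmoothProjective (cyclicCoverPoint p f)) 2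
  have hTΓ : T ∈ ratMonodromyGroup (cyclicCoverFamily p) 2 (cyclicCoverFamily_locallyTrivial p)
      ⟨cyclicCoverPoint p f, Set.mem_univ _⟩ := mem_ratMonodromyGroup_of_isRatTransport _ _ _ hT
  exact exists_cyclicReflection_data_of_localisation hp (transportedTraceForm hX e 2)
    (transportedTraceForm_nondegenerate hX e) T τ
    (transportedTraceForm_of_mem_ratMonodromyGroup hf hX hJ e hTΓ) W hrange hTτ hsum hdim hW0

end Summit.HodgeConjecture.HodgeConjecture.Theorems.CyclicUnitaryPowersMonodromyIsometry

end
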